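import Mathlib
import Literature.NumberTheory.Transcendental.KZCalculus

/-!
# Crux `TorsionLogs.NeronTorsionSector` (stmt-KontsevichZagierPeriods-14500) — assembly, log-class calculus

Helpers for the lead's stub `stub_assembly` (line `registered`). A formal combination `F : KZ.FormalRep` is a
*log class of value `v`* if, modulo `KZ.relations`, it is a `ℤ`-combination of INTERVAL LOG CARRIERS
`[(αᵢ, βᵢ), dt/t]` (`0 < αᵢ ≤ βᵢ` real algebraic) whose values add up to `v`:
`∃ κ α β ε cs, (∀ i, 0 < α i ∧ α i ≤ β i ∧ IsAlgebraic ℚ (α i) ∧ IsAlgebraic ℚ (β i) ∧ (cs i).domain = … ∧ …)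
 ∧ Σ εᵢ log(βᵢ/αᵢ) = v ∧ F − Σ εᵢ•[csᵢ] ∈ relations` — exactly the output shape of `stub_dlogUnfold` /
`stub_logStep`. No definition is introduced (the block is spelled out); this file proves that log classes are
closed under `0`, `+`, `−`, `ℤ`-multiples, finite sums and congruence modulo `relations` (concatenation of
families along `Fin.append`). [cite: KontsevichZagier2001, §1.2]
-/

noncomputable section

open Set
open Literature.NumberTheory.Transcendental Literature.NumberTheory.Transcendental.KZ

-- `Summit.KontsevichZagierPeriods.KontsevichZagierPeriods.…` is the tree's mandated layout (single-conjunct summit).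
set_option linter.dupNamespace false

namespace Summit.KontsevichZagierPeriods.KontsevichZagierPeriods.Cruxes.NeronTorsionSector.Translation

/-- The zero combination is a log class of value `0` (empty family). [cite: KontsevichZagier2001, §1.2] -/
theorem logClass_zero :
    ∃ (κ : ℕ) (α β : Fin κ → ℝ) (ε : Fin κ → ℤ) (cs : Fin κ → IntegralRep 1),
      (∀ i, 0 < α i ∧ α i ≤ β i ∧ IsAlgebraic ℚ (α i) ∧ IsAlgebraic ℚ (β i) ∧
        (cs i).domain = {t | α i < t 0 ∧ t 0 < β i} ∧
        Set.EqOn (cs i).integrand (fun t => 1 / t 0) (cs i).domain) ∧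
      ∑ i, (ε i : ℝ) * Real.log (β i / α i) = 0 ∧
      (0 : FormalRep) - ∑ i, ε i • of (cs i) ∈ relations := by
  refine ⟨0, Fin.elim0, Fin.elim0, Fin.elim0, Fin.elim0, fun i => i.elim0, by simp, ?_⟩
  simp [relations.zero_mem]

/-- Log classes are closed under addition (concatenate the families along `Fin.append`).
[cite: KontsevichZagier2001, §1.2] -/
theorem logClass_add {F F' : FormalRep} {v v' : ℝ}
    (h : ∃ (κ : ℕ) (α β : Fin κ → ℝ) (ε : Fin κ → ℤ) (cs : Fin κ → IntegralRep 1),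
      (∀ i, 0 < α i ∧ α i ≤ β i ∧ IsAlgebraic ℚ (α i) ∧ IsAlgebraic ℚ (β i) ∧
        (cs i).domain = {t | α i < t 0 ∧ t 0 < β i} ∧
        Set.EqOn (cs i).integrand (fun t => 1 / t 0) (cs i).domain) ∧
      ∑ i, (ε i : ℝ) * Real.log (β i / α i) = v ∧ F - ∑ i, ε i • of (cs i) ∈ relations)
    (h' : ∃ (κ : ℕ) (α β : Fin κ → ℝ) (ε : Fin κ → ℤ) (cs : Fin κ → IntegralRep 1),
      (∀ i, 0 < α i ∧ α i ≤ β i ∧ IsAlgebraic ℚ (α i) ∧ IsAlgebraic ℚ (β i) ∧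
        (cs i).domain = {t | α i < t 0 ∧ t 0 < β i} ∧
        Set.EqOn (cs i).integrand (fun t => 1 / t 0) (cs i).domain) ∧
      ∑ i, (ε i : ℝ) * Real.log (β i / α i) = v' ∧ F' - ∑ i, ε i • of (cs i) ∈ relations) :
    ∃ (κ : ℕ) (α β : Fin κ → ℝ) (ε : Fin κ → ℤ) (cs : Fin κ → IntegralRep 1),
      (∀ i, 0 < α i ∧ α i ≤ β i ∧ IsAlgebraic ℚ (α i) ∧ IsAlgebraic ℚ (β i) ∧
        (cs i).domain = {t | α i < t 0 ∧ t 0 < β i} ∧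
        Set.EqOn (cs i).integrand (fun t => 1 / t 0) (cs i).domain) ∧
      ∑ i, (ε i : ℝ) * Real.log (β i / α i) = v + v' ∧
      (F + F') - ∑ i, ε i • of (cs i) ∈ relations := by
  obtain ⟨κ, α, β, ε, cs, hcs, hsum, hrel⟩ := h
  obtain ⟨κ', α', β', ε', cs', hcs', hsum', hrel'⟩ := h'
  refine ⟨κ + κ', Fin.append α α', Fin.append β β', Fin.append ε ε', Fin.append cs cs', ?_, ?_, ?_⟩
  · intro i
    refine Fin.addCases (fun j => ?_) (fun j => ?_) i
    · simpa using hcs j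
    · simpa using hcs' j
  · rw [Fin.sum_univ_add]
    simp only [Fin.append_left, Fin.append_right]
    rw [hsum, hsum']
  · rw [Fin.sum_univ_add]
    simp only [Fin.append_left, Fin.append_right]
    have e : F + F' - (∑ i : Fin κ, ε i • of (cs i) + ∑ i : Fin κ', ε' i • of (cs' i)) =
        (F - ∑ i, ε i • of (cs i)) + (F' - ∑ i, ε' i • of (cs' i)) := by abel
    rw [e]
    exact relations.add_mem hrel hrel'

/-- Log classes are closed under `ℤ`-multiples (multiply the coefficients). [cite: KontsevichZagier2001, §1.2] -/
theorem logClass_zsmul (z : ℤ) {F : FormalRep} {v : ℝ}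
    (h : ∃ (κ : ℕ) (α β : Fin κ → ℝ) (ε : Fin κ → ℤ) (cs : Fin κ → IntegralRep 1),
      (∀ i, 0 < α i ∧ α i ≤ β i ∧ IsAlgebraic ℚ (α i) ∧ IsAlgebraic ℚ (β i) ∧
        (cs i).domain = {t | α i < t 0 ∧ t 0 < β i} ∧
        Set.EqOn (cs i).integrand (fun t => 1 / t 0) (cs i).domain) ∧
      ∑ i, (ε i : ℝ) * Real.log (β i / α i) = v ∧ F - ∑ i, ε i • of (cs i) ∈ relations) :
    ∃ (κ : ℕ) (α β : Fin κ → ℝ) (ε : Fin κ → ℤ) (cs : Fin κ → IntegralRep 1),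
      (∀ i, 0 < α i ∧ α i ≤ β i ∧ IsAlgebraic ℚ (α i) ∧ IsAlgebraic ℚ (β i) ∧
        (cs i).domain = {t | α i < t 0 ∧ t 0 < β i} ∧
        Set.EqOn (cs i).integrand (fun t => 1 / t 0) (cs i).domain) ∧
      ∑ i, (ε i : ℝ) * Real.log (β i / α i) = z * v ∧
      z • F - ∑ i, ε i • of (cs i) ∈ relations := by
  obtain ⟨κ, α, β, ε, cs, hcs, hsum, hrel⟩ := h
  refine ⟨κ, α, β, fun i => z * ε i, cs, hcs, ?_, ?_⟩
  · rw [← hsum, Finset.mul_sum]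
    refine Finset.sum_congr rfl fun i _ => ?_
    push_cast
    ring
  · have e : z • F - ∑ i, (z * ε i) • of (cs i) = z • (F - ∑ i, ε i • of (cs i)) := by
      rw [smul_sub, Finset.smul_sum]
      congr 1
      refine Finset.sum_congr rfl fun i _ => ?_
      rw [mul_smul]
    rw [e]
    exact relations.zsmul_mem hrel z

/-- Log classes are closed under negation. [cite: KontsevichZagier2001, §1.2] -/
theorem logClass_neg {F : FormalRep} {v : ℝ}
    (h : ∃ (κ : ℕ) (α β : Fin κ → ℝ) (ε : Fin κ → ℤ) (cs : Fin κ → IntegralRep 1),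
      (∀ i, 0 < α i ∧ α i ≤ β i ∧ IsAlgebraic ℚ (α i) ∧ IsAlgebraic ℚ (β i) ∧
        (cs i).domain = {t | α i < t 0 ∧ t 0 < β i} ∧
        Set.EqOn (cs i).integrand (fun t => 1 / t 0) (cs i).domain) ∧
      ∑ i, (ε i : ℝ) * Real.log (β i / α i) = v ∧ F - ∑ i, ε i • of (cs i) ∈ relations) :
    ∃ (κ : ℕ) (α β : Fin κ → ℝ) (ε : Fin κ → ℤ) (cs : Fin κ → IntegralRep 1),
      (∀ i, 0 < α i ∧ α i ≤ β i ∧ IsAlgebraic ℚ (α i) ∧ IsAlgebraic ℚ (β i) ∧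
        (cs i).domain = {t | α i < t 0 ∧ t 0 < β i} ∧
        Set.EqOn (cs i).integrand (fun t => 1 / t 0) (cs i).domain) ∧
      ∑ i, (ε i : ℝ) * Real.log (β i / α i) = -v ∧
      (-F) - ∑ i, ε i • of (cs i) ∈ relations := by
  have h1 := logClass_zsmul (-1) h
  simpa using h1

/-- Log classes are invariant under congruence modulo `relations`. [cite: KontsevichZagier2001, §1.2] -/
theorem logClass_congr {F F' : FormalRep} {v : ℝ} (hFF' : F - F' ∈ relations)
    (h : ∃ (κ : ℕ) (α β : Fin κ → ℝ) (ε : Fin κ → ℤ) (cs : Fin κ → IntegralRep 1),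
      (∀ i, 0 < α i ∧ α i ≤ β i ∧ IsAlgebraic ℚ (α i) ∧ IsAlgebraic ℚ (β i) ∧
        (cs i).domain = {t | α i < t 0 ∧ t 0 < β i} ∧
        Set.EqOn (cs i).integrand (fun t => 1 / t 0) (cs i).domain) ∧
      ∑ i, (ε i : ℝ) * Real.log (β i / α i) = v ∧ F - ∑ i, ε i • of (cs i) ∈ relations) :
    ∃ (κ : ℕ) (α β : Fin κ → ℝ) (ε : Fin κ → ℤ) (cs : Fin κ → IntegralRep 1),
      (∀ i, 0 < α i ∧ α i ≤ β i ∧ IsAlgebraic ℚ (α i) ∧ IsAlgebraic ℚ (β i) ∧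
        (cs i).domain = {t | α i < t 0 ∧ t 0 < β i} ∧
        Set.EqOn (cs i).integrand (fun t => 1 / t 0) (cs i).domain) ∧
      ∑ i, (ε i : ℝ) * Real.log (β i / α i) = v ∧ F' - ∑ i, ε i • of (cs i) ∈ relations := by
  obtain ⟨κ, α, β, ε, cs, hcs, hsum, hrel⟩ := h
  refine ⟨κ, α, β, ε, cs, hcs, hsum, ?_⟩
  have e : F' - ∑ i, ε i • of (cs i) = (F - ∑ i, ε i • of (cs i)) - (F - F') := by abel
  rw [e]
  exact relations.sub_mem hrel hFF'

/-- Finite sums of log classes are log classes (values add). [cite: KontsevichZagier2001, §1.2] -/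
theorem logClass_sum {ι : Type*} (s : Finset ι) (F : ι → FormalRep) (v : ι → ℝ)
    (h : ∀ j ∈ s, ∃ (κ : ℕ) (α β : Fin κ → ℝ) (ε : Fin κ → ℤ) (cs : Fin κ → IntegralRep 1),
      (∀ i, 0 < α i ∧ α i ≤ β i ∧ IsAlgebraic ℚ (α i) ∧ IsAlgebraic ℚ (β i) ∧
        (cs i).domain = {t | α i < t 0 ∧ t 0 < β i} ∧
        Set.EqOn (cs i).integrand (fun t => 1 / t 0) (cs i).domain) ∧
      ∑ i, (ε i : ℝ) * Real.log (β i / α i) = v j ∧ F j - ∑ i, ε i • of (cs i) ∈ relations) :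
    ∃ (κ : ℕ) (α β : Fin κ → ℝ) (ε : Fin κ → ℤ) (cs : Fin κ → IntegralRep 1),
      (∀ i, 0 < α i ∧ α i ≤ β i ∧ IsAlgebraic ℚ (α i) ∧ IsAlgebraic ℚ (β i) ∧
        (cs i).domain = {t | α i < t 0 ∧ t 0 < β i} ∧
        Set.EqOn (cs i).integrand (fun t => 1 / t 0) (cs i).domain) ∧
      ∑ i, (ε i : ℝ) * Real.log (β i / α i) = ∑ j ∈ s, v j ∧
      (∑ j ∈ s, F j) - ∑ i, ε i • of (cs i) ∈ relations := by
  classical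
  induction s using Finset.induction_on with
  | empty => simpa using logClass_zero
  | insert a s ha ih =>
    rw [Finset.sum_insert ha, Finset.sum_insert ha]
    exact logClass_add (h a (Finset.mem_insert_self a s))
      (ih fun j hj => h j (Finset.mem_insert_of_mem hj))

/-- Finite `ℤ`-combinations of log classes are log classes. [cite: KontsevichZagier2001, §1.2] -/
theorem logClass_sum_zsmul {ι : Type*} (s : Finset ι) (z : ι → ℤ) (F : ι → FormalRep) (v : ι → ℝ)
    (h : ∀ j ∈ s, ∃ (κ : ℕ) (α β : Fin κ → ℝ) (ε : Fin κ → ℤ) (cs : Fin κ → IntegralRep 1),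
      (∀ i, 0 < α i ∧ α i ≤ β i ∧ IsAlgebraic ℚ (α i) ∧ IsAlgebraic ℚ (β i) ∧
        (cs i).domain = {t | α i < t 0 ∧ t 0 < β i} ∧
        Set.EqOn (cs i).integrand (fun t => 1 / t 0) (cs i).domain) ∧
      ∑ i, (ε i : ℝ) * Real.log (β i / α i) = v j ∧ F j - ∑ i, ε i • of (cs i) ∈ relations) :
    ∃ (κ : ℕ) (α β : Fin κ → ℝ) (ε : Fin κ → ℤ) (cs : Fin κ → IntegralRep 1),
      (∀ i, 0 < α i ∧ α i ≤ β i ∧ IsAlgebraic ℚ (α i) ∧ IsAlgebraic ℚ (β i) ∧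
        (cs i).domain = {t | α i < t 0 ∧ t 0 < β i} ∧
        Set.EqOn (cs i).integrand (fun t => 1 / t 0) (cs i).domain) ∧
      ∑ i, (ε i : ℝ) * Real.log (β i / α i) = ∑ j ∈ s, (z j : ℝ) * v j ∧
      (∑ j ∈ s, z j • F j) - ∑ i, ε i • of (cs i) ∈ relations :=
  logClass_sum s (fun j => z j • F j) (fun j => (z j : ℝ) * v j)
    (fun j hj => logClass_zsmul (z j) (h j hj))

/-- A single interval log carrier `[(a, b), dt/t]` (`0 < a ≤ b` real algebraic) is a log class of value
`log (b/a)`. [cite: KontsevichZagier2001, §1.2] -/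
theorem logClass_carrier : ∀ {a b : ℝ}, 0 < a → a ≤ b → IsAlgebraic ℚ a → IsAlgebraic ℚ b → ∀ (r : Literature.NumberTheory.Transcendental.KZ.IntegralRep 1), r.domain = {t | a < t 0 ∧ t 0 < b} → Set.EqOn r.integrand (fun t => 1 / t 0) r.domain → ∃ (κ : ℕ) (α β : Fin κ → ℝ) (ε : Fin κ → ℤ) (cs : Fin κ → Literature.NumberTheory.Transcendental.KZ.IntegralRep 1), (∀ i, 0 < α i ∧ α i ≤ β i ∧ IsAlgebraic ℚ (α i) ∧ IsAlgebraic ℚ (β i) ∧ (cs i).domain = {t | α i < t 0 ∧ t 0 < β i} ∧ Set.EqOn (cs i).integrand (fun t => 1 / t 0) (cs i).domain) ∧ ∑ i, (ε i : ℝ) * Real.log (β i / α i) = Real.log (b / a) ∧ Literature.NumberTheory.Transcendental.KZ.of r - ∑ i, ε i • Literature.NumberTheory.Transcendental.KZ.of (cs i) ∈ Literature.NumberTheory.Transcendental.KZ.relations := by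
  intro a b ha hab haa hba r hd hi
  refine ⟨1, fun _ => a, fun _ => b, fun _ => 1, fun _ => r, fun _ => ⟨ha, hab, haa, hba, hd, hi⟩,
    by simp, ?_⟩
  simp [relations.zero_mem]

end Summit.KontsevichZagierPeriods.KontsevichZagierPeriods.Cruxes.NeronTorsionSector.Translation
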